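import Summits.ResolutionOfSingularities.KangarooAtlas.MizutaniRationalExponent
import Summits.ResolutionOfSingularities.KangarooAtlas.MizutaniExtremal
import HarnessLib

/-!
# The dual of an extremal point is extremal with the same exponent (Mizutani Prop. 2.5 / Thm. 2.8, Step (I))

Cell `pub-rosobs`, Mizutani enclosure (seat mizutani-encloser-1, gen 8).  AI-written; *AI review is weaker than
expert review*; NOT a resolution-of-singularities theorem (summit relevance C).

Two corollaries of `exponentLE_ratPoint` (`MizutaniRationalExponent.lean`: every `k^{1/q}`-rational point
`[c^{1/q}] = ratPoint k p e c` has a Hironaka scheme of exponent `≤ e`):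

* **`hsDim_ratPoint_add_finrank`** — `dim B([c^{1/q}]) + dim_k (L_B)_e = n + 1`: the dimension of the scheme of a
  `k^{1/q}`-rational point is read at level `e` ALONE, where `(L_B)_e = {a : Σ_i a_i ⊗ c_i ∈ J^q}`
  (`mem_invForms_ratPoint_iff_zero`); the in-house note's Prop. 3.1 «`dim B ≥ n − d`» is an equality here.
* **`exponent_dual_of_extremal`** — for a point `𝔭` of `ℙ^{2p−1}_k` with no linear form through it and a nonzero
  `a ∈ (L_B)_1(𝔭)` (the extremal configuration of Thm. 2.8: `extremal_of_card_eq` gives `𝔭 = [c^{1/p}]`,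
  `(L_B)_1(𝔭) = k∙a`, and the DUAL point `𝔭* = [a^{1/p}]` with `(L_B)_0(𝔭*) = 0`, `(L_B)_1(𝔭*) = k∙c`):
  `exponent B(𝔭) = 1 = exponent B(𝔭*)` and `dim B(𝔭*) + 1 = 2p` — Mizutani's «evidently `e(H) = e(H*)` and
  `H** = H`» (Prop. 2.5) and «`2p − 1 ≤ dim H* < 2p`, hence `dim H* = 2p − 1`» (Step (I)) for this configuration;
  `dual_of_extremal_hironaka` says the same about `B_{P,𝔭*} = Spec S/U_+(𝔭*)S` (not a vector group, Krull
  dimension `2p − 1`).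

## References

* H. Mizutani, *Hironaka's additive group schemes*, Nagoya Math. J. 52 (1973) 85–95, Def. 2.2, Prop. 2.5, Thm. 2.8
  (proof, Step (I)). [Mizutani1973HironakaGroupSchemes]
* T. Oda, *Hironaka's additive group scheme, II*, Publ. RIMS 19 (1983), Cor. 2.3, Thm. 3.1. [Oda1983HironakaGroupSchemeII]
-/

noncomputable section

open MvPolynomial TensorProduct Literature.AlgebraicGeometry.Resolution
  Literature.AlgebraicGeometry.Resolution.HironakaScheme

namespace Summit.ResolutionOfSingularities.KangarooAtlas.Mizutani

universe u

section Dual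

variable (k : Type u) [Field k] (p : ℕ) [hp : Fact p.Prime] [CharP k p] {n : ℕ}

/-- **`dim B([c^{1/q}]) + dim_k (L_B)_e([c^{1/q}]) = n + 1`**: since the point has exponent `≤ e`
(`exponentLE_ratPoint`), Oda's rank formula may be read at level `e`, where `(L_B)_e = {a : Σ a_i ⊗ c_i ∈ J^q}`
(`mem_invForms_ratPoint_iff_zero`). [cite: Oda1983HironakaGroupSchemeII, §2 (p. 1168: "the dimension of B(𝔭) equals the rank of L/L_B") and Cor. 2.3] -/
theorem hsDim_ratPoint_add_finrank (e : ℕ) (c : Fin (n + 1) → k) :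
    hsDim k p (ratPoint k p e c) + Module.finrank k (invForms k p (ratPoint k p e c) e) = n + 1 := by
  rw [← hsDimAt_eq_hsDim k p _ (exponentLE_ratPoint k p e c)]
  unfold hsDimAt
  have := finrank_invForms_le k p (ratPoint k p e c) e
  omega

variable {k p}

/-- **The extremal configuration of Thm. 2.8 is self-dual with the same exponent**: for a point `𝔭` of `ℙ^{2p−1}_k`
through which no linear form passes and a nonzero `a ∈ (L_B)_1(𝔭)`, both `𝔭 = [c^{1/p}]` and its dual point
`𝔭* = [a^{1/p}]` have exponent exactly `1`, and `dim B(𝔭*) + 1 = 2p` («`2p − 1 ≤ dim H* < 2p`», Step (I);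
«`e(H) = e(H*)`», Prop. 2.5). [cite: Mizutani1973HironakaGroupSchemes, Thm. 2.8 proof Step (I) and Prop. 2.5] -/
theorem exponent_dual_of_extremal {𝔭 : Ideal (MvPolynomial (Fin (n + 1)) k)} (hP : IsPoint k 𝔭)
    (h0 : invForms k p 𝔭 0 = ⊥) (hn : n + 1 = 2 * p) {a : Fin (n + 1) → k} (ha : a ∈ invForms k p 𝔭 1) (ha0 : a ≠ 0) :
    exponent k p 𝔭 = 1 ∧ exponent k p (ratPoint k p 1 a) = 1 ∧ hsDim k p (ratPoint k p 1 a) + 1 = 2 * p := by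
  obtain ⟨c, hc, h𝔭, hV, haind, -, hV'⟩ := extremal_of_card_eq k p 𝔭 hP h0 hn ha ha0
  have hc0 : c ≠ 0 := fun hz => hc.ne_zero 0 (congrFun hz 0)
  have hex𝔭 : exponent k p 𝔭 = 1 := by
    rw [h𝔭]
    refine exponent_ratPoint_eq_one k p hc ?_
    rw [← h𝔭, hV]
    exact fun h => ha0 (Submodule.span_singleton_eq_bot.mp h)
  have hexa : exponent k p (ratPoint k p 1 a) = 1 :=
    exponent_ratPoint_eq_one k p haind (by rw [hV']; exact fun h => hc0 (Submodule.span_singleton_eq_bot.mp h))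
  refine ⟨hex𝔭, hexa, ?_⟩
  have hsum := hsDim_ratPoint_add_finrank k p 1 a
  rw [hV', finrank_span_singleton hc0] at hsum
  omega

/-- **The same in Hironaka's vocabulary**: the dual point `𝔭* = [a^{1/p}]` is a point of `ℙ^{2p−1}_k` whose scheme
`B_{P,𝔭*} = Spec S/U_+(𝔭*)S` is NOT a vector group and has `dim B_{P,𝔭*} + 1 = 2p`, with no linear form through `𝔭*`
(`(L_B)_0 = U(𝔭*) ∩ L_0 = 0`, `hirForms_eq_invForms`) — i.e. `𝔭*` is again extremal in the sense of Thm. 2.8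
(«`H*` is an H-scheme … `H** = H`»).
[cite: Mizutani1973HironakaGroupSchemes, Prop. 2.5 and Thm. 2.8 proof Step (I)] -/
theorem dual_of_extremal_hironaka {𝔭 : Ideal (MvPolynomial (Fin (n + 1)) k)} (hP : IsPoint k 𝔭)
    (h0 : invForms k p 𝔭 0 = ⊥) (hn : n + 1 = 2 * p) {a : Fin (n + 1) → k} (ha : a ∈ invForms k p 𝔭 1) (ha0 : a ≠ 0) :
    IsPoint k (ratPoint k p 1 a) ∧ invForms k p (ratPoint k p 1 a) 0 = ⊥ ∧ ¬ IsVectorGroup k (ratPoint k p 1 a) ∧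
      ringKrullDim (MvPolynomial (Fin (n + 1)) k ⧸ bIdeal k (ratPoint k p 1 a)) + 1 = (2 * p : WithBot ℕ∞) := by
  haveI := (ratPoint_isPrime (k := k) (p := p) (e := 1) (c := a))
  obtain ⟨-, hexa, hdim⟩ := exponent_dual_of_extremal hP h0 hn ha ha0
  obtain ⟨c, -, -, -, -, h0', -⟩ := extremal_of_card_eq k p 𝔭 hP h0 hn ha ha0
  have hPa : IsPoint k (ratPoint k p 1 a) := isPoint_ratPoint ha0
  refine ⟨hPa, h0', ?_, ?_⟩
  · rw [isVectorGroup_iff_exponent_eq_zero_holds k p _ hPa, hexa]; exact one_ne_zero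
  · rw [ringKrullDim_quotient_bIdeal_eq_hsDim_holds k p _ hPa]
    exact_mod_cast congrArg (fun m : ℕ => (m : WithBot ℕ∞)) hdim

end Dual

end Summit.ResolutionOfSingularities.KangarooAtlas.Mizutani

end
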